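import Summits.CriticalPhenomena.PercolationContinuityZ3.Theorems.Transplant.VPathKit
import HarnessLib

/-!
# The DIAMOND swap gadget: a swap pair of `VRouteData` from four paths around a 4-cycle `c ∼ y ∼ d ∼ b ∼ c`

builds on p205010 (kernel theorem, internal audit signed; external expert review pending) — NOT used in this file.  Lane `prim-bschramm`, seat
`prim-bschramm-p2` (gen 34; class C1b; memo `HOME/bschramm/P2-LATTICES.md` §127–§128); helper file (`--supports stmt-CriticalPhenomena-4575 --as helper`).
The node `HexShadow.ShapedLinkage` («HexShadowVRouteData») asks for a SWAP PAIR: two routings with the successor `y` of the attachment vertex and the first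
branch vertex `b` exchanged.  The template of memo §127 realises it LOCALLY (graph-generic, this file): given a 4-cycle `c ∼ y ∼ d ∼ b ∼ c` (in `F_k`: the hub
`c = (q, ℓ)`, `y = (q+u_a, ℓ+1)`, `b = (q+u_b, ℓ+1)`, `d = (q−u_c, ℓ+2)`), a path `A : E₁ ⇝ c`, a path `B : d ⇝ E₂`, and two INDEPENDENT branch tails
`T₁ : b ⇝ w'` (off `A, y, B`) and `T₂ : y ⇝ w'` (off `A, b, B`), the routings `(A · y · B, T₁)` and `(A · b · B, T₂)` form a swap pair
(**`VRouteData.exists_swap_of_diamond`**).  [cite: DuminilCopinSidoraviciusTassion2016, §2.3 (proof of Fact 2: γ_u, γ_v, γ_w and "(z,v) ≺ (z,w)")]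
-/

noncomputable section

namespace Summit.CriticalPhenomena.PercolationContinuityZ3.Theorems.Transplant

open SimpleGraph
open scoped Classical

namespace VRouteData

variable {V : Type} {G : SimpleGraph V}

/-- **The rerouted chain through one side of the diamond**: `A ++ m :: B` is a self-avoiding path `E₁ ⇝ E₂` when `A : E₁ ⇝ c`, `B : d ⇝ E₂`, `c ∼ m ∼ d`,
`m` off both and `A`, `B` disjoint. [folklore] -/
theorem gpath_through {A B : List V} {E₁ E₂ c d m : V} (hA : GPath G A E₁ c) (hB : GPath G B d E₂) (hcm : G.Adj c m) (hmd : G.Adj m d)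
    (hmA : m ∉ A) (hmB : m ∉ B) (hAB : ∀ x ∈ B, x ∉ A) : GPath G (A ++ m :: B) E₁ E₂ := by
  have h1 : GPath G (A ++ [m]) E₁ m := by
    have := hA.trans (GPath.pair hcm) (fun v hv hvA => by
      rcases List.mem_cons.1 hv with rfl | hv
      · rfl
      · simp only [List.mem_singleton] at hv; exact absurd (hv ▸ hvA) hmA)
    simpa using this
  have h2 : GPath G (m :: B) m E₂ := hB.cons hmd hmB
  have := h1.trans h2 (fun v hv hv1 => by
    rcases List.mem_cons.1 hv with rfl | hv
    · rfl
    · rcases List.mem_append.1 hv1 with h | h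
      · exact absurd h (hAB v hv)
      · simp only [List.mem_singleton] at h; exact absurd (h ▸ hv) hmB)
  simpa using this

/-- In `A ++ m :: B` with `A` ending at `c`, the vertex `m` follows `c`. [folklore] -/
theorem split_through {A B : List V} {E₁ c m : V} (hA : GPath G A E₁ c) : ∃ l₁ l₂ : List V, A ++ m :: B = l₁ ++ c :: m :: l₂ := by
  refine ⟨A.dropLast, B, ?_⟩
  conv_lhs => rw [← List.dropLast_append_getLast hA.ne_nil, hA.getLast_eq]
  simp

/-- **THE DIAMOND SWAP PAIR.**  Around a 4-cycle `c ∼ y ∼ d ∼ b ∼ c`: from `A : E₁ ⇝ c`, `B : d ⇝ E₂` (disjoint, off `y, b`), `T₁ : b ⇝ w'` off `A ++ y :: B`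
and `T₂ : y ⇝ w'` off `A ++ b :: B`, with `A, y, b, B` inside `W_R` and `T₁, T₂` inside `W`, the routings `(A ++ y :: B, c, y, T₁)` and
`(A ++ b :: B, c, b, T₂)` are routing data with the successor of `c` and the first branch vertex exchanged.
[cite: DuminilCopinSidoraviciusTassion2016, §2.3 (proof of Fact 2: γ_u, γ_v, γ_w, "(z,v) ≺ (z,w)")] -/
theorem exists_swap_of_diamond {WR W : Set V} {E₁ E₂ w' c y b d : V} {A B T₁ T₂ : List V} (hne : E₁ ≠ E₂)
    (hA : GPath G A E₁ c) (hB : GPath G B d E₂) (hT₁ : GPath G T₁ b w') (hT₂ : GPath G T₂ y w')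
    (hcy : G.Adj c y) (hcb : G.Adj c b) (hyd : G.Adj y d) (hbd : G.Adj b d)
    (hyA : y ∉ A) (hyB : y ∉ B) (hbA : b ∉ A) (hbB : b ∉ B) (hAB : ∀ x ∈ B, x ∉ A)
    (hT₁off : ∀ x ∈ T₁, x ∉ A ++ y :: B) (hT₂off : ∀ x ∈ T₂, x ∉ A ++ b :: B)
    (hAW : ∀ x ∈ A, x ∈ WR) (hBW : ∀ x ∈ B, x ∈ WR) (hyW : y ∈ WR) (hbW : b ∈ WR) (hT₁W : ∀ x ∈ T₁, x ∈ W) (hT₂W : ∀ x ∈ T₂, x ∈ W) :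
    ∃ r₁ r₂ : VRouteData G WR W E₁ E₂ w', r₁.y = r₂.b ∧ r₁.b = r₂.y := by
  have hSP₁ := gpath_through hA hB hcy hyd hyA hyB hAB
  have hSP₂ := gpath_through hA hB hcb hbd hbA hbB hAB
  have hin₁ : ∀ x ∈ (A ++ y :: B).tail.dropLast, x ∈ WR := by
    intro x hx
    have hx' : x ∈ A ++ y :: B := List.mem_of_mem_tail (List.dropLast_subset _ hx)
    rcases List.mem_append.1 hx' with h | h
    · exact hAW x h
    · rcases List.mem_cons.1 h with rfl | h
      · exact hyW
      · exact hBW x h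
  have hin₂ : ∀ x ∈ (A ++ b :: B).tail.dropLast, x ∈ WR := by
    intro x hx
    have hx' : x ∈ A ++ b :: B := List.mem_of_mem_tail (List.dropLast_subset _ hx)
    rcases List.mem_append.1 hx' with h | h
    · exact hAW x h
    · rcases List.mem_cons.1 h with rfl | h
      · exact hbW
      · exact hBW x h
  refine ⟨ofPaths hSP₁ hne hin₁ (split_through hA) hT₁ hT₁W hcb hT₁off, ofPaths hSP₂ hne hin₂ (split_through hA) hT₂ hT₂W hcy hT₂off, ?_, ?_⟩
  · rw [ofPaths_y, ofPaths_b]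
  · rw [ofPaths_b, ofPaths_y]

end VRouteData

end Summit.CriticalPhenomena.PercolationContinuityZ3.Theorems.Transplant

end
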